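import Summits.QuantumFields.QCD.Theorems.SpectralDefectExtinctionWindowExtinctionCornerSingleLinkResonance
import Summits.QuantumFields.QCD.Theorems.SpectralDefectExtinctionWindowExtinctionCornerTwoLineDecayOfSingleLink

/-!
# Stub `stub_twoLineDecay` (S2, the lever) of line `corner-decorrelation-deep-hole` — two-line decay
(crux `Summit.QuantumFields.QCD.Theses.SpectralDefectExtinction.WindowExtinction`, item stmt-QuantumFields-18063)

**Registered signature, proved.**  There are `c₁, C, C₀ > 0` such that for `N_f ≤ 3`, `β ≥ 1`, odd tori
`2S+1 ≥ C₀√β`, masses `μ_f ≥ −1` and path lengths `1 ≤ n ≤ β³`, the `∏_f|det D_W(U,μ_f,1)|`-weighted Wilson mean of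
`‖(4·1 − D_W(U,0,1))ⁿ‖_F²` is `≤ C (2S+1)⁴ (4 − c₁/β)^{2n}`.  Proof: the landed reduction
`twoLineDecay_of_singleLinkResonance` (S2 ⇐ S2a + S2b + S2d + S2e ⇐ S2c, all landed) applied to the single-link
resonance anti-concentration `stub_singleLinkResonance` (S2c, landed in `…CornerSingleLinkResonance`).
-/

noncomputable section

namespace Summit.QuantumFields.QCD.Cruxes.WindowExtinction.CornerDecorrelationDeepHole

open scoped BigOperators Matrix
open MeasureTheory
open Literature.MathematicalPhysics.QuantumLattice Literature.MathematicalPhysics.QuantumFieldTheory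
  Literature.Probability.LatticeModels

/-- **S2 · TWO-LINE DECAY** (registered stub `stub_twoLineDecay` of line `corner-decorrelation-deep-hole`, crux
`WindowExtinction`, item stmt-QuantumFields-18063): the phase-quenched annealed second moment of the Wilson hopping
operator `K_U = 4·1 − D_W(U,0,1)` grows at rate `≤ 4 − c₁/β` up to path length `β³` on tori of side `≥ C₀√β`. -/
theorem stub_twoLineDecay :
    ∃ c₁ C C₀ : ℝ, 0 < c₁ ∧ 0 < C ∧ 0 < C₀ ∧ ∀ Nf : ℕ, Nf ≤ 3 → ∀ β : ℝ, 1 ≤ β → ∀ S : ℕ, C₀ * Real.sqrt β ≤ 2 * S + 1 → ∀ μ : Fin Nf → ℝ, (∀ f, -1 ≤ μ f) → ∀ n : ℕ, 1 ≤ n → (n : ℝ) ≤ β ^ 3 → (∫ U, (∑ i, ∑ j, ‖(((4 : ℂ) • (1 : Matrix (QuarkIdx (2 * S + 1)) (QuarkIdx (2 * S + 1)) ℂ) - wilsonDirac (fundamentalRep (Fin 3)) U 0 1) ^ n) i j‖ ^ 2) * ∏ f : Fin Nf, ‖fermionDet (wilsonDirac (fundamentalRep (Fin 3)) U (μ f)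 1)‖ ∂(wilsonMeasure (d := 4) (L := 2 * S + 1) (fundamentalRep (Fin 3)) β)) / (∫ U, ∏ f : Fin Nf, ‖fermionDet (wilsonDirac (fundamentalRep (Fin 3)) U (μ f) 1)‖ ∂(wilsonMeasure (d := 4) (L := 2 * S + 1) (fundamentalRep (Fin 3)) β)) ≤ C * (2 * S + 1 : ℝ) ^ 4 * (4 - c₁ / β) ^ (2 * n) :=
  twoLineDecay_of_singleLinkResonance stub_singleLinkResonance

end Summit.QuantumFields.QCD.Cruxes.WindowExtinction.CornerDecorrelationDeepHole

end
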